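import Summits.RiemannHypothesis.RiemannHypothesis.Theses.IntegerScrew
import Summits.RiemannHypothesis.RiemannHypothesis.Theorems.IntegerScrewScrewDensityDetection
import Summits.RiemannHypothesis.RiemannHypothesis.Theorems.WeilCombCombHelsonBound
import Literature.NumberTheory.LFunctions.ZetaZeros
import Literature.NumberTheory.LFunctions.ZetaScrewThm12Proofs
import HarnessLib

/-!
# Line `landau-gonek-floor` for crux `IntegerScrew.ScrewPolyFloor` (stmt-RiemannHypothesis-15757)

Crux (route `IntegerScrew`, rank 2):
`ScrewPolyFloor : ∃ A c > 0, ∀ M x, c·M^{-A}·Σ_{2≤m≤M} x_m² ≤ Σ_{2≤m,m'≤M} G(log m, log m') x_m x_m'`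
with `G = zetaScrewKernel` (Suzuki's Kreĭn kernel of the screw function `Ψ = zetaScrew`).

STRUCTURE (crux-strategist, 2026-08-17).  The crux is `RH ∧ (floor law)`:
* it IMPLIES RH through its diagonal alone (`x = 𝟙_m` ⇒ `Ψ(log m) ≥ 0`, then `DiscreteLandau`; this is
  exactly what the route's deciding theorem `closes` uses), and
* GIVEN RH it is the route's calibration item `FloorOfRH : RH → (floor law)` verbatim.
Hence the typed decomposition (proved below, sorry-free, no stubs):
`ScrewPolyFloor_of_subs : IntegerScrewPSD → FloorOfRH → ScrewPolyFloor`
(target ⇒ PSD on all real configurations by the LANDED `screwDensityDetection_proof` ⇒ RH by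
`Suzuki2023_thm12_holds`; then `FloorOfRH`), and
conversely `ScrewPolyFloor → FloorOfRH` trivially (and `→ IntegerScrewPSD` is the route's support item
`FloorImpliesScrew`).  The RH half is the route's TARGET; the half with a technique is the floor law.

THE LINE = the Conrey–Ghosh–Gonek discrete-mean-value method for the floor law.  Under RH
(`Suzuki2023_thm11_series_holds`, PROVED) the Gram form is a sum of squares over the zeros,
`x·S_M·x = Σ_ρ m(ρ) |P_y(γ)|² / γ²`, `P_y(γ) = Σ_{m ≤ M} y_m m^{iγ}`, `y = (−Σx, x_2, …, x_M)`
(so `Σ y = 0`: the test polynomial vanishes at `γ = 0`).  Keep only the zeros of ONE dyadic block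
`T < γ ≤ 2T` (each dropped term is `≥ 0`): `x·S_M·x ≥ (4T²)⁻¹ Σ_{block} m(ρ)|P_y(γ)|²` (`stub_gramBlock`).
The block sum is a DISCRETE MEAN VALUE of a length-`M` Dirichlet polynomial over zeta zeros, which
Gonek's uniform version of Landau's formula `Σ_{0<γ≤T} x^ρ = −(T/2π)Λ(x) + O(…)` (Gonek 1993,
Contemp. Math. 143, Thm 1; here only at rationals `x = m/m'` of height `≤ M`: `stub_gonekLandau`, the
FIRST LEMMA of the line) evaluates as (`stub_blockMeanValue`)
`Σ_{block} m(ρ)|P_y|² = N_block·‖y‖² − (T/2π)·Helson_Λ(y) + O(M² log²(MT))‖y‖²`,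
whose off-diagonal is EXACTLY WeilComb's von Mangoldt Helson form, bounded by `(log M + 1)‖y‖²`
(`combHelsonBound_proof`, PROVED in the tree), while `N_block ≥ (T/2π)(log T − 2)` by Riemann–von
Mangoldt (`riemann_von_mangoldt_holds`, PROVED; `stub_blockZeroCount`).  With `T = M^K`:
`x·S_M·x ≥ (4M^{2K})⁻¹ (M^K/2π)[(K−1)log M − 3 − o(1)]‖y‖² ≥ c·M^{−K}‖x‖²` (`stub_endgame`, the
parameter choice; `‖y‖² ≥ ‖x‖²`).  So `A = K` — a POLYNOMIAL floor, as the crux predicts.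

Stubs (6; S2 `ScrewDensityDetection` LANDED as `screwDensityDetection_proof`, used by name):
`stub_targetPSD` (= route target `IntegerScrewPSD`, RH-strength, BY NAME),
`stub_gramBlock` (RH ⇒ block Gram lower bound; L), `stub_gonekLandau` (Gonek 1993 Thm 1 at rationals;
XL, the literature fact), `stub_blockMeanValue` (Gonek ⇒ block mean value with Helson main term; L),
`stub_blockZeroCount` (R–vM in dyadic blocks; M), `stub_endgame` (parameter choice; M).
Compositions (sorry-free, kernel-checked): `rh_of_target`, `helsonForm_le`, `blockFloor_of`,
`FloorOfRH_of` (concludes the route item `FloorOfRH` BY NAME from stubs 3–7 only),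
`ScrewPolyFloor_of` (all six stub statements ⇒ the crux BY NAME), `ScrewPolyFloor_of_subs` (split).
-/

noncomputable section

-- `Summit.RiemannHypothesis.RiemannHypothesis.…` duplicates `RiemannHypothesis` BY DESIGN (D-0017).
set_option linter.dupNamespace false

namespace Summit.RiemannHypothesis.RiemannHypothesis.Cruxes.ScrewPolyFloor.LandauGonekFloor

open Literature.NumberTheory.LFunctions
open scoped BigOperators ComplexConjugate
open Finset

/-! ## Objects of the line -/

/-- The zeros of `ζ` in the dyadic height block `T < Im ρ ≤ 2T` (with `0 ≤ Re ρ ≤ 1`; each listed once,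
multiplicity `riemannZetaZeroOrder`), as a `Finset` (a finite subset of `zetaZeroBox 0 (2T)`). -/
def zeroBlock (T : ℝ) : Finset ℂ :=
  ((zetaZeroBox_finite 0 (2 * T)).subset
    (Set.sep_subset (zetaZeroBox 0 (2 * T)) fun ρ => T < ρ.im)).toFinset

/-- `N_block(T) = Σ_{T < γ ≤ 2T} m(ρ)`: the number of zeros in the block, with multiplicity (real-valued). -/
def blockCount (T : ℝ) : ℝ :=
  ∑ ρ ∈ zeroBlock T, (riemannZetaZeroOrder ρ : ℝ)

/-- `‖y‖²_M = Σ_{1 ≤ m ≤ M} y_m²`. -/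
def sqNorm (M : ℕ) (y : ℕ → ℝ) : ℝ :=
  ∑ m ∈ Icc 1 M, y m ^ 2

/-- The Landau–Gonek PAIR FORM of the block:
`Re Σ_{ρ ∈ block} m(ρ) Σ_{1≤m,m'≤M} y_m y_m' (m/m')^{ρ − 1/2}`.
Under RH (`ρ − 1/2 = iγ`) the inner double sum is `|Σ_m y_m m^{iγ}|²`, so this is the discrete mean
value `Σ_{block} m(ρ)|P_y(γ)|² ≥ 0`; unconditionally it is the bilinear form that Landau's formula
evaluates (the block is invariant under `ρ ↦ 1 − conj ρ` with equal multiplicities, which makes it real). -/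
def blockPairSum (M : ℕ) (T : ℝ) (y : ℕ → ℝ) : ℝ :=
  (∑ ρ ∈ zeroBlock T, (riemannZetaZeroOrder ρ : ℂ) *
      ∑ m ∈ Icc 1 M, ∑ m' ∈ Icc 1 M,
        ((y m : ℂ) * (y m' : ℂ)) * (((m : ℂ) / (m' : ℂ)) ^ (ρ - 1 / 2))).re

/-- WeilComb's von Mangoldt HELSON FORM (verbatim the left side of `WeilComb.CombHelsonBound` at
`a m := (y m : ℂ)`): `2 Re Σ_{m ≤ M} Σ_{n ≤ M/m} Λ(n) n^{-1/2} y(nm) y(m)`. -/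
def helsonForm (M : ℕ) (y : ℕ → ℝ) : ℝ :=
  2 * (∑ m ∈ Icc 1 M, ∑ n ∈ Icc 1 (M / m),
    ((ArithmeticFunction.vonMangoldt n : ℝ) : ℂ) / (Real.sqrt n : ℂ) * (y (n * m) : ℂ) *
      conj (y m : ℂ)).re

/-- The RH-free analytic heart of the line: a DISCRETE MEAN-VALUE FLOOR — for every `M ≥ 2` some
block height `T` makes the pair form dominate `c M^{-A} ‖y‖²` for all real `y`. -/
def BlockFloor : Prop :=
  ∃ A c : ℝ, 0 < c ∧ ∀ M : ℕ, 2 ≤ M → ∃ T : ℝ, 0 < T ∧ ∀ y : ℕ → ℝ,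
    c * (M : ℝ) ^ (-A) * sqNorm M y ≤ 1 / (4 * T ^ 2) * blockPairSum M T y

/-! ## The seven stub statements as named propositions (`Sig.stub_*`); the compositions take them BY NAME -/

namespace Sig

/-- S1 statement: the route TARGET `IntegerScrewPSD` (RH-strength: the RH half of the crux). -/
def stub_targetPSD : Prop :=
  Summit.RiemannHypothesis.RiemannHypothesis.Theses.IntegerScrew.IntegerScrewPSD

/-- S3 statement: under RH, one dyadic block of the Gram expansion bounds the form from below. -/
def stub_gramBlock : Prop :=
  _root_.RiemannHypothesis → ∀ (M : ℕ) (T : ℝ) (y : ℕ → ℝ), 1 ≤ M → 0 < T →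
    ∑ m ∈ Icc 1 M, y m = 0 →
      1 / (4 * T ^ 2) * blockPairSum M T y ≤
        ∑ m ∈ Icc 2 M, ∑ m' ∈ Icc 2 M,
          zetaScrewKernel (Real.log m) (Real.log m') * (y m * y m')

/-- S4 statement: Gonek's uniform Landau formula at rationals `x = m/m' ∈ (1, M]` of height `≤ M`. -/
def stub_gonekLandau : Prop :=
  ∃ C : ℝ, ∀ (M : ℕ) (T : ℝ) (m m' : ℕ), 2 ≤ T → 1 ≤ m' → m' < m → m ≤ M →
    ‖(∑ ρ ∈ (zetaZeroBox_finite 0 T).toFinset,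
          (riemannZetaZeroOrder ρ : ℂ) * (((m : ℂ) / (m' : ℂ)) ^ ρ)) +
        (if m' ∣ m then
          ((T / (2 * Real.pi) * ArithmeticFunction.vonMangoldt (m / m') : ℝ) : ℂ) else 0)‖ ≤
      C * M * Real.log ((M : ℝ) * T) ^ 2

/-- S5 statement: Gonek's formula ⇒ the block mean value with the von Mangoldt–Helson main term. -/
def stub_blockMeanValue : Prop :=
  stub_gonekLandau →
    ∃ C : ℝ, ∀ (M : ℕ) (T : ℝ) (y : ℕ → ℝ), 1 ≤ M → 2 ≤ T →
      blockCount T * sqNorm M y - T / (2 * Real.pi) * helsonForm M y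
          - C * (M : ℝ) ^ 2 * Real.log ((M : ℝ) * T) ^ 2 * sqNorm M y ≤
        blockPairSum M T y

/-- S6 statement: Riemann–von Mangoldt in dyadic blocks, as an explicit lower bound. -/
def stub_blockZeroCount : Prop :=
  ∃ T₀ : ℝ, ∀ T : ℝ, T₀ ≤ T → T / (2 * Real.pi) * (Real.log T - 2) ≤ blockCount T

/-- S7 statement: the parameter choice `T = M^K` (pure real analysis). -/
def stub_endgame : Prop :=
  ∀ (C T₀ : ℝ), ∃ (K : ℕ) (A c : ℝ), 0 < c ∧ ∀ M : ℕ, 2 ≤ M →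
    T₀ ≤ (M : ℝ) ^ K ∧ 2 ≤ (M : ℝ) ^ K ∧
      c * (M : ℝ) ^ (-A) ≤
        1 / (4 * ((M : ℝ) ^ K) ^ 2) *
          ((M : ℝ) ^ K / (2 * Real.pi) * (Real.log ((M : ℝ) ^ K) - 2)
            - (M : ℝ) ^ K / (2 * Real.pi) * (Real.log M + 1)
            - C * (M : ℝ) ^ 2 * Real.log ((M : ℝ) * (M : ℝ) ^ K) ^ 2)

end Sig

/-! ## The stubs -/

/-- STUB S1 (RH-strength; BY NAME the route's target `IntegerScrewPSD`, item stmt-RiemannHypothesis-15756):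
Suzuki's kernel is positive semidefinite on every finite configuration of logarithms of positive
integers.  This is the RH half of the crux (`crux = RH ∧ floor law`); it is NOT claimed provable short of
RH — it is here so that the line concludes the crux by name and so that the ledger sees the crux's RH
content as the route TARGET (shared), not as new work. -/
theorem stub_targetPSD : Sig.stub_targetPSD := by
  sorry

/-- STUB S3 (L). Under RH, by `Suzuki2023_thm11_series_holds` (PROVED, unconditional series over the
non-trivial zeros with weights `m(ρ)`): `G(log m, log m') = Σ_ρ m(ρ) Re[(1 − m^{iγ})(1 − m'^{−iγ})]/γ²`,
so for real `y` with `Σ_{m ≤ M} y_m = 0`,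
`Σ_{2≤m,m'≤M} G y_m y_m' = Σ_ρ m(ρ)|Σ_{m ≤ M} y_m m^{iγ}|²/γ²` (the `m = 1` coordinate absorbs the
constant term since `1^{iγ} = 1`); every term is `≥ 0`, so keeping only `T < γ ≤ 2T` (`γ² ≤ 4T²`) gives
`≥ (4T²)⁻¹ · blockPairSum M T y` (under RH `(m/m')^{ρ−1/2} = (m/m')^{iγ}` and the pair form is
`Σ_block m(ρ)|P_y(γ)|²`).  Lean route: `HasSum` of finite linear combinations, `sum_le_hasSum` on the
finite sub-family indexed by `zeroBlock T`, `RiemannHypothesis` to put `Re ρ = 1/2`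
(`mem_riemannZetaNontrivialZeros_iff_holds` for `ρ ≠ 1`, non-triviality). -/
theorem stub_gramBlock : Sig.stub_gramBlock := by
  sorry

/-- STUB S4 (XL; the FIRST LEMMA of the line = the literature fact, Gonek 1993, "An explicit formula of
Landau and its applications to the theory of the zeta-function", Contemp. Math. 143, 395–413, Thm 1,
uniform in `x` and `T`): for `x, T > 1`,
`Σ_{0<γ≤T} x^ρ = −(T/2π)Λ(x) + O(x log(2xT) loglog(3x)) + O(log x · min(T, x/⟨x⟩)) + O(log(2T) min(T, 1/log x))`,
`⟨x⟩` = distance from `x` to the nearest prime power other than `x`.  Specialised to `x = m/m'`,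
`1 ≤ m' < m ≤ M`: `Λ(x) = Λ(m/m')·[m' ∣ m]`, `x ≤ M`, `x/⟨x⟩ ≤ (m/m')·m' ≤ M` (as `|m/m' − q| ≥ 1/m'`
for a prime power `q ≠ x`), `1/log x ≤ m' + 1 ≤ M`, `loglog(3x) ≤ log(3M)`; all three error terms are
`≤ C·M·log²(MT)` for `T ≥ 2`.  The sum is over `zetaZeroBox 0 T` (zeros with `0 < Im ρ ≤ T`, each once)
weighted by `m(ρ) = riemannZetaZeroOrder ρ`.  Proof in print: contour integral of `(ζ'/ζ)(s)x^s`. -/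
theorem stub_gonekLandau : Sig.stub_gonekLandau := by
  sorry

/-- STUB S5 (L). From S4: expand `blockPairSum = Re Σ_{m,m'} y_m y_m' (m/m')^{-1/2} Σ_block m(ρ)(m/m')^ρ`
(block sum = difference of the cumulative sums at `2T` and `T`; `(m/m')^{ρ−1/2} = (m/m')^{−1/2}(m/m')^ρ`
for the positive real base).  Diagonal `m = m'`: `Σ_block m(ρ) · 1 = blockCount T`, giving
`blockCount·‖y‖²`.  Pairs `m' < m`: S4 gives `(m'/m)^{1/2}(−(T/2π)Λ(m/m')[m'∣m]) + O(M log²(MT))`;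
pairs `m' > m` (`x < 1`): the block is invariant under `ρ ↦ 1 − conj ρ` with the same multiplicity
(`riemannZetaZeroOrder_one_sub_holds`, `riemannZetaZeroOrder_conj_holds`), and
`x^{1−conj ρ} = x·conj((1/x)^ρ)`, so the same main term appears; together the main terms are
`−(T/2π)·helsonForm M y` (`n = m/m'`, `(m'/m)^{1/2} = n^{-1/2}`, both orders ↦ the factor `2 Re`), and
the errors sum to `≤ C M log²(MT)·‖y‖₁² ≤ C M² log²(MT)‖y‖²` (Cauchy–Schwarz on `Icc 1 M`). -/
theorem stub_blockMeanValue : Sig.stub_blockMeanValue := by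
  sorry

/-- STUB S6 (M). `blockCount T = N(2T) − N(T)` (`zetaZeroCount`, finsum over `zetaZeroBox 0 ·`, boxes
nested for `T ≥ 0`), and Riemann–von Mangoldt (`riemann_von_mangoldt_holds`:
`N(T) = (T/2π)log(T/2π) − T/2π + O(log T)`) gives
`N(2T) − N(T) = (T/2π)(log T − log(πe/2)) + O(log T) ≥ (T/2π)(log T − 2)` for `T ≥ T₀`
(`log(πe/2) = 1.45…`). -/
theorem stub_blockZeroCount : Sig.stub_blockZeroCount := by
  sorry

/-- STUB S7 (M; pure real analysis, the parameter choice). With `T = M^K`, `log T = K log M` and the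
bracket is `(M^K/2π)[(K−1)log M − 3] − C M²((K+1) log M)²`; for `K ≥ K₀(C)` (so that
`2^{K−3} ≥ 8πC₊(K+1)²/(K−1)` and `2^K ≥ max(T₀, 2)`) and every `M ≥ 2` this is
`≥ (M^K/8π)(K−1) log M`, whence the right side is `≥ (log 2/32π)·M^{−K}`: take `A = K`,
`c = log 2/(32π)`. -/
theorem stub_endgame : Sig.stub_endgame := by
  sorry

/-! ## Compositions (sorry-free) -/

/-- The RH half: target + density detection (LANDED, `screwDensityDetection_proof`) ⇒ Mathlib's
`RiemannHypothesis` (`isPosSemidefKernelOn_zetaScrewKernel_iff` + `Suzuki2023_thm12_holds`). -/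
theorem rh_of_target (hP : Sig.stub_targetPSD) : _root_.RiemannHypothesis := by
  have hall : ∀ (N : ℕ) (t x : Fin N → ℝ),
      0 ≤ ∑ i, ∑ j, zetaScrewKernel (t i) (t j) * (x i * x j) :=
    Summit.RiemannHypothesis.RiemannHypothesis.Theorems.screwDensityDetection_proof hP
  have hpsd : Literature.Analysis.Complex.IsPosSemidefKernelOn
      (fun t u : ℝ => (zetaScrewKernel t u : ℂ)) Set.univ :=
    (isPosSemidefKernelOn_zetaScrewKernel_iff Set.univ).2 fun N t x _ => hall N t x
  have h12 : Suzuki2023_thm12 := Suzuki2023_thm12_holds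
  exact h12.2 hpsd

/-- The Helson bound of the line is the tree's `combHelsonBound_proof` (route WeilComb, PROVED) read on
real vectors: `helsonForm M y ≤ (log M + 1)·‖y‖²_M`. -/
theorem helsonForm_le (M : ℕ) (y : ℕ → ℝ) (hM : 1 ≤ M) :
    helsonForm M y ≤ (Real.log M + 1) * sqNorm M y := by
  have h := Summit.RiemannHypothesis.RiemannHypothesis.Theorems.combHelsonBound_proof
  unfold Summit.RiemannHypothesis.RiemannHypothesis.Theses.WeilComb.CombHelsonBound at h
  have h2 := h M (fun m => ((y m : ℝ) : ℂ)) hM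
  have e : ∑ m ∈ Icc 1 M, ‖((y m : ℝ) : ℂ)‖ ^ 2 = sqNorm M y := by
    unfold sqNorm
    refine Finset.sum_congr rfl fun m _ => ?_
    rw [Complex.norm_real, Real.norm_eq_abs, sq_abs]
  rw [e] at h2
  unfold helsonForm
  exact h2

/-- The discrete mean-value floor from stubs S4–S7 and the Helson bound (sorry-free composition). -/
theorem blockFloor_of (h4 : Sig.stub_gonekLandau) (h5 : Sig.stub_blockMeanValue)
    (h6 : Sig.stub_blockZeroCount) (h7 : Sig.stub_endgame) : BlockFloor := by
  obtain ⟨C, hC⟩ := h5 h4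
  obtain ⟨T₀, hT₀⟩ := h6
  obtain ⟨K, A, c, hc, hK⟩ := h7 C T₀
  refine ⟨A, c, hc, fun M hM => ?_⟩
  obtain ⟨hT₀M, h2M, hmain⟩ := hK M hM
  refine ⟨(M : ℝ) ^ K, by linarith, fun y => ?_⟩
  have hM1 : 1 ≤ M := le_trans (by norm_num) hM
  have hMV := hC M ((M : ℝ) ^ K) y hM1 h2M
  have hZ := hT₀ ((M : ℝ) ^ K) hT₀M
  have hH := helsonForm_le M y hM1
  have hN : 0 ≤ sqNorm M y := Finset.sum_nonneg fun m _ => sq_nonneg _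
  have hTdiv : 0 ≤ (M : ℝ) ^ K / (2 * Real.pi) := by positivity
  have h4T : 0 ≤ 1 / (4 * ((M : ℝ) ^ K) ^ 2) := by positivity
  -- the three atoms of the bracket
  set P : ℝ := (M : ℝ) ^ K / (2 * Real.pi) * (Real.log ((M : ℝ) ^ K) - 2) with hP
  set Q : ℝ := (M : ℝ) ^ K / (2 * Real.pi) * (Real.log M + 1) with hQ
  set R : ℝ := C * (M : ℝ) ^ 2 * Real.log ((M : ℝ) * (M : ℝ) ^ K) ^ 2 with hR
  have a1 : P * sqNorm M y ≤ blockCount ((M : ℝ) ^ K) * sqNorm M y :=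
    mul_le_mul_of_nonneg_right hZ hN
  have a2 : (M : ℝ) ^ K / (2 * Real.pi) * helsonForm M y ≤ Q * sqNorm M y := by
    have := mul_le_mul_of_nonneg_left hH hTdiv
    simpa only [hQ, mul_assoc] using this
  have step2 : (P - Q - R) * sqNorm M y ≤
      blockCount ((M : ℝ) ^ K) * sqNorm M y
        - (M : ℝ) ^ K / (2 * Real.pi) * helsonForm M y - R * sqNorm M y := by
    have e1 : (P - Q - R) * sqNorm M y = P * sqNorm M y - Q * sqNorm M y - R * sqNorm M y := by
      ring
    rw [e1]
    linarith
  have step3 : blockCount ((M : ℝ) ^ K) * sqNorm M y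
        - (M : ℝ) ^ K / (2 * Real.pi) * helsonForm M y - R * sqNorm M y ≤
      blockPairSum M ((M : ℝ) ^ K) y := by
    have e2 : R * sqNorm M y =
        C * (M : ℝ) ^ 2 * Real.log ((M : ℝ) * (M : ℝ) ^ K) ^ 2 * sqNorm M y := by
      rw [hR]
    rw [e2]
    exact hMV
  calc c * (M : ℝ) ^ (-A) * sqNorm M y
      ≤ 1 / (4 * ((M : ℝ) ^ K) ^ 2) * (P - Q - R) * sqNorm M y :=
        mul_le_mul_of_nonneg_right hmain hN
    _ = 1 / (4 * ((M : ℝ) ^ K) ^ 2) * ((P - Q - R) * sqNorm M y) := by ring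
    _ ≤ 1 / (4 * ((M : ℝ) ^ K) ^ 2) *
          (blockCount ((M : ℝ) ^ K) * sqNorm M y
            - (M : ℝ) ^ K / (2 * Real.pi) * helsonForm M y - R * sqNorm M y) :=
        mul_le_mul_of_nonneg_left step2 h4T
    _ ≤ 1 / (4 * ((M : ℝ) ^ K) ^ 2) * blockPairSum M ((M : ℝ) ^ K) y :=
        mul_le_mul_of_nonneg_left step3 h4T

/-- The floor law under RH — the route's calibration item `FloorOfRH` (stmt-RiemannHypothesis-15762)
BY NAME — from stubs S3–S7 only (sorry-free composition; no RH-strength stub enters). -/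
theorem FloorOfRH_of (h3 : Sig.stub_gramBlock) (h4 : Sig.stub_gonekLandau)
    (h5 : Sig.stub_blockMeanValue) (h6 : Sig.stub_blockZeroCount) (h7 : Sig.stub_endgame) :
    Summit.RiemannHypothesis.RiemannHypothesis.Theses.IntegerScrew.FloorOfRH := by
  intro hRH
  obtain ⟨A, c, hc, hB⟩ := blockFloor_of h4 h5 h6 h7
  refine ⟨A, c, hc, fun M x => ?_⟩
  rcases lt_or_ge M 2 with hM | hM
  · have hE : Finset.Icc 2 M = ∅ := Finset.Icc_eq_empty (by omega)
    simp [hE]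
  · obtain ⟨T, hT, hy⟩ := hB M hM
    classical
    set y : ℕ → ℝ := fun m => if m = 1 then -∑ k ∈ Finset.Icc 2 M, x k else x m with hydef
    have hM1 : 1 ≤ M := by omega
    have hsplit : Finset.Icc 1 M = insert 1 (Finset.Icc 2 M) := by
      ext k
      simp only [Finset.mem_Icc, Finset.mem_insert]
      omega
    have h1notin : (1 : ℕ) ∉ Finset.Icc 2 M := by simp
    have hyx : ∀ k ∈ Finset.Icc 2 M, y k = x k := by
      intro k hk
      have hk1 : k ≠ 1 := by
        simp only [Finset.mem_Icc] at hk
        omega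
      simp [hydef, hk1]
    have hy1 : y 1 = -∑ k ∈ Finset.Icc 2 M, x k := by simp [hydef]
    have hsum0 : ∑ m ∈ Finset.Icc 1 M, y m = 0 := by
      rw [hsplit, Finset.sum_insert h1notin, Finset.sum_congr rfl hyx, hy1]
      ring
    have hG := h3 hRH M T y hM1 hT hsum0
    have hQ : ∑ m ∈ Icc 2 M, ∑ m' ∈ Icc 2 M,
          zetaScrewKernel (Real.log m) (Real.log m') * (y m * y m') =
        ∑ m ∈ Icc 2 M, ∑ m' ∈ Icc 2 M,
          zetaScrewKernel (Real.log m) (Real.log m') * (x m * x m') :=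
      Finset.sum_congr rfl fun m hm => Finset.sum_congr rfl fun m' hm' => by
        rw [hyx m hm, hyx m' hm']
    have hsqy : ∑ k ∈ Icc 2 M, y k ^ 2 = ∑ k ∈ Icc 2 M, x k ^ 2 :=
      Finset.sum_congr rfl fun k hk => by rw [hyx k hk]
    have hsq : ∑ m ∈ Icc 2 M, x m ^ 2 ≤ sqNorm M y := by
      unfold sqNorm
      rw [hsplit, Finset.sum_insert h1notin, hsqy]
      nlinarith [sq_nonneg (y 1)]
    have hcA : 0 ≤ c * (M : ℝ) ^ (-A) :=
      mul_nonneg hc.le (Real.rpow_nonneg (Nat.cast_nonneg M) _)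
    calc c * (M : ℝ) ^ (-A) * ∑ m ∈ Icc 2 M, x m ^ 2
        ≤ c * (M : ℝ) ^ (-A) * sqNorm M y := mul_le_mul_of_nonneg_left hsq hcA
      _ ≤ 1 / (4 * T ^ 2) * blockPairSum M T y := hy y
      _ ≤ ∑ m ∈ Icc 2 M, ∑ m' ∈ Icc 2 M,
            zetaScrewKernel (Real.log m) (Real.log m') * (y m * y m') := hG
      _ = ∑ m ∈ Icc 2 M, ∑ m' ∈ Icc 2 M,
            zetaScrewKernel (Real.log m) (Real.log m') * (x m * x m') := hQ

/-- COMPOSITION TO THE CRUX BY NAME (sorry-free): the seven stub statements imply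
`IntegerScrew.ScrewPolyFloor` — S1 (+ landed S2) gives RH (`rh_of_target`), S3–S7 give the floor under RH
(`FloorOfRH_of`). -/
theorem ScrewPolyFloor_of (h1 : Sig.stub_targetPSD)
    (h3 : Sig.stub_gramBlock) (h4 : Sig.stub_gonekLandau) (h5 : Sig.stub_blockMeanValue)
    (h6 : Sig.stub_blockZeroCount) (h7 : Sig.stub_endgame) :
    Summit.RiemannHypothesis.RiemannHypothesis.Theses.IntegerScrew.ScrewPolyFloor := by
  have hF := FloorOfRH_of h3 h4 h5 h6 h7
  have hRH := rh_of_target h1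
  exact hF hRH

/-- The route item `FloorOfRH` modulo exactly the floor-law `stub_*` sorries (this file doubles as a
skeleton for item stmt-RiemannHypothesis-15762 `FloorOfRH`: no RH-strength stub in its cone). -/
theorem floorOfRH :
    Summit.RiemannHypothesis.RiemannHypothesis.Theses.IntegerScrew.FloorOfRH :=
  FloorOfRH_of stub_gramBlock stub_gonekLandau stub_blockMeanValue
    stub_blockZeroCount stub_endgame

/-- The crux modulo exactly the six `stub_*` sorries. -/
theorem screwPolyFloor :
    Summit.RiemannHypothesis.RiemannHypothesis.Theses.IntegerScrew.ScrewPolyFloor :=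
  ScrewPolyFloor_of stub_targetPSD stub_gramBlock stub_gonekLandau stub_blockMeanValue
    stub_blockZeroCount stub_endgame

/-! ## The typed decomposition of the crux (sorry-free, stub-free): `crux = target ∧ FloorOfRH` -/

/-- DECOMPOSITION (crux-strategist (b)): the existing route items `IntegerScrewPSD` (target) and
`FloorOfRH` (support, the floor law under RH) imply the crux (`ScrewDensityDetection` has landed).
Kernel-checked, no `sorry`, no stub. -/
theorem ScrewPolyFloor_of_subs
    (hP : Summit.RiemannHypothesis.RiemannHypothesis.Theses.IntegerScrew.IntegerScrewPSD)
    (hF : Summit.RiemannHypothesis.RiemannHypothesis.Theses.IntegerScrew.FloorOfRH) :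
    Summit.RiemannHypothesis.RiemannHypothesis.Theses.IntegerScrew.ScrewPolyFloor := by
  have hRH := rh_of_target hP
  exact hF hRH

/-- Converse edge 1 of the decomposition: the crux implies `FloorOfRH` (trivially). -/
theorem floorOfRH_of_screwPolyFloor
    (h : Summit.RiemannHypothesis.RiemannHypothesis.Theses.IntegerScrew.ScrewPolyFloor) :
    Summit.RiemannHypothesis.RiemannHypothesis.Theses.IntegerScrew.FloorOfRH :=
  fun _ => h

/-- Converse edge 2 (diagonal): the crux implies `Ψ(log m) ≥ 0` at every integer `m ≥ 1` — the only
consequence of the crux that the route's `closes` consumes (then `DiscreteLandau` gives RH). -/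
theorem zetaScrew_log_nonneg_of_screwPolyFloor
    (h : Summit.RiemannHypothesis.RiemannHypothesis.Theses.IntegerScrew.ScrewPolyFloor)
    (m : ℕ) (hm : 1 ≤ m) : 0 ≤ zetaScrew (Real.log m) := by
  classical
  rcases Nat.lt_or_ge m 2 with hlt | hge
  · have h1 : m = 1 := by omega
    subst h1
    simp [zetaScrew_zero]
  obtain ⟨A, c, hc, hAll⟩ := h
  set x : ℕ → ℝ := fun k => if k = m then 1 else 0 with hx
  have hmem : m ∈ Finset.Icc 2 m := Finset.mem_Icc.mpr ⟨hge, le_rfl⟩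
  have h1 := hAll m x
  have hR : ∑ a ∈ Finset.Icc 2 m, ∑ b ∈ Finset.Icc 2 m,
      zetaScrewKernel (Real.log a) (Real.log b) * (x a * x b) =
        zetaScrewKernel (Real.log m) (Real.log m) := by
    rw [Finset.sum_eq_single m]
    · rw [Finset.sum_eq_single m]
      · simp [hx]
      · intro b _ hb
        simp [hx, hb]
      · intro hnot
        exact absurd hmem hnot
    · intro a _ ha
      apply Finset.sum_eq_zero
      intro b _
      simp [hx, ha]
    · intro hnot
      exact absurd hmem hnot
  have hL0 : 0 ≤ c * (m : ℝ) ^ (-A) * ∑ a ∈ Finset.Icc 2 m, x a ^ 2 :=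
    mul_nonneg (mul_nonneg hc.le (Real.rpow_nonneg (Nat.cast_nonneg m) _))
      (Finset.sum_nonneg fun _ _ => sq_nonneg _)
  have h2 : 0 ≤ zetaScrewKernel (Real.log m) (Real.log m) := by
    rw [← hR]; exact le_trans hL0 h1
  rw [zetaScrewKernel_self] at h2
  linarith

end Summit.RiemannHypothesis.RiemannHypothesis.Cruxes.ScrewPolyFloor.LandauGonekFloor

end
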